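import Summits.ResolutionOfSingularities.ResolutionOfSingularities.Theorems.WeightedInvariantLocalWeightedDropTOT2EndBridge

/-!
# TOT2-LINE, piece S-ASM (outer half): the PHASE ASSEMBLY on the head `(o, c)` — from «every phase lowers the head or ends in a normal
# crossing» to the positional rank of `stub_spaceNCRankDrop`; plus transport of decorated winning between state types

Crux item stmt-ResolutionOfSingularities-8899 `WeightedInvariant.LocalWeightedDrop` (route `ResolutionOfSingularities/WeightedInvariant`), ENGINE
skeleton v32 (ddb48572591139d5), registered residual `stub_spaceNCRankDrop`; TOT2-LINE v1 §1/§7 and v1.1 (E) «S-ASM: `DWinsTo.bind` per phase +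
`wf_induction` on `(o, c)` + extraction `ncRankDrop_of_dWinsTo`» (res-L1-w43-lead-1 g4, `L/res-L1-w43-lead-1/g4/TOT2-LINE.md`).
[OURS · L1 W4.3 · seat res-L1-w43-stub-1 gen 6; def-free game bookkeeping over the settings layer S-SET (`Decoration`, `Admissible`, `Decoration.head`,
`admissible_start`) and the decorated calculus `DWinsTo` (p528575); the count game is the programme's own; NOT a statement of any manuscript;
AI-produced, gate-checked, weaker than expert review.]

WHAT THIS FILE SETTLES (and what it leaves to the regime hands).  The DECORATED STATES of the line are the pairs `(b, δ)` — a position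
`b ∈ k⟦x₀,…,x_m⟧` with a decoration `δ` (strict transform `f`, boundary letters `E ⊇ O` old) — read through `germ := Prod.fst`; the admissible ones
(`Admissible b δ`, S-SET) are the states the strategy visits.  The regime theorems of the line (S-E0/S-E1/S-E2′/S-CRV for `o ≥ 2`, S-END for `o ≤ 1`)
are «inside one equi-`(o,c)` phase the mover forces an exit»; their common currency is
`DWinsTo Prod.fst (fun τ => GermIsNC τ.1 ∨ (Admissible τ.1 τ.2 ∧ τ.2.head < δ.head)) (b, δ)` — «from `(b, δ)` the mover forces a normal crossing or an
admissibly decorated position of strictly smaller head `(o, c)`» (res-type-056's S-E1 INTERFACE 12:52:13Z uses exactly the second disjunct as target).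

* `DWinsTo.map`, `DWinsTo.of_subtype` — TRANSPORT of decorated winning along any germ-preserving map of state types (image region, least-rank
  bookkeeping).  Use: res-D-pv-006's S-END (`dWinsTo_end_of_rung`, …TOT2EndBridge) lives on the SUBTYPE `{p // Admissible p.1 p.2}`, res-type-056's
  S-E1 on the PRODUCT type; `endPhase_of_rung` moves the former to the latter, so every phase theorem is consumed on ONE state type.
* `DWinsTo.of_wfMeasure`, `DWinsTo.of_noChain` — regime theorems in MEASURE form with the measure valued in ANY well-founded relation /
  any relation without infinite descending sequences (generalising `DWinsTo.of_measure`): the form in which the landed label theories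
  (`PolyDescent.stub_polyNoChain`, …) are consumed by S-E2′.
* `dWinsTo_germIsNC_of_headPhase` — THE OUTER INDUCTION: if from every admissible state the mover forces «NC, or admissible of smaller head», then
  from every admissible state it forces NC (`WellFoundedLT` induction on `Decoration.head : ℕ ×ₗ ℕ` and `DWinsTo.bind`; no ordinal coding).
* `headPhase_of_high_of_end` — the head phase from its two halves: the `o ≥ 2` phase with target «admissible of smaller head» and the `o ≤ 1` endgame.
* `highPhase_of_step` — THE INNER INDUCTION of the `o ≥ 2` phase: «smaller head, or same head and smaller secondary measure `ν`» (any well-founded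
  `ν`: apex dimension, conflict count, label rank, lex combinations) ⇒ the `o ≥ 2` phase.
* `ncRankDrop_of_headPhase`, `ncRankDrop_of_high_of_end`, `ncRankDrop_of_highPhase_of_rung` — EXTRACTION of the positional statement (one ordinal rank
  on germs lowered by some move at every answer from every non-zero non-NC germ) via `admissible_start` + `ncRankDrop_of_dWinsTo` + radical heredity
  of `GermIsNC`; the last one takes the endgame from the bare rung R8 (`hR8`, being kernelled by res-D-pv-006 / res-L1-w43-strat-1).
* `spaceNCRankDrop_of_highPhase_of_rung` — the registered stub's TEXT at `m + 1 = 3` (binders `∀ p prime, ∀ k, [Field k] [CharP k p] [IsAlgClosed k]`)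
  from the `o ≥ 2` phase and R8, both under the same binders.
* `omega0_mul_add_lt_omega0_mul_add_of_lt`, `omega0_mul_add_lt_iff`, `Decoration.head_lt_iff_omega0` — convenience for hands that feed
  `DWinsTo.of_measure` / `DWinsTo.wf_induction` with ORDINAL measures: `δ′.head < δ.head ↔ ω·o′ + c′ < ω·o + c`.

NOT here (TOT2-LINE §3/§7, res-L1-w43-lead-1's S-STRAT / S-ASM proper): the INNER composition of the `o ≥ 2` phase from the regime exits
(apex dimension `e^O`, conflict states, near/non-near answers).
-/

set_option linter.dupNamespace false -- mandated namespace of this single-conjunct summit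

namespace Summit.ResolutionOfSingularities.ResolutionOfSingularities.Theorems

namespace TameFourTupleDrop

open MvPowerSeries Literature.AlgebraicGeometry.Resolution

variable {k : Type} [Field k] {m : ℕ} {St St' : Type}

/-! ## Transport of decorated winning along germ-preserving maps of state types -/

/-- **TRANSPORT.**  Let `φ : St' → St` preserve germs (`germ (φ τ') = germ' τ'`) and carry the target `Q'` into the target `Q`.  If `σ'` wins
towards `Q'` on `St'`, then `φ σ'` wins towards `Q` on `St` — region: the image of the `St'`-region; rank of an image state: the least rank of a
preimage in the region (that preimage supplies the move). -/
theorem DWinsTo.map {germ : St → MvPowerSeries (Fin (m + 1)) k} {germ' : St' → MvPowerSeries (Fin (m + 1)) k}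
    (φ : St' → St) (hφ : ∀ τ', germ (φ τ') = germ' τ') {Q : St → Prop} {Q' : St' → Prop} (hQ : ∀ τ', Q' τ' → Q (φ τ'))
    {σ' : St'} (h : DWinsTo germ' Q' σ') : DWinsTo germ Q (φ σ') := by
  classical
  obtain ⟨T', ρ', hT', hσ'⟩ := h
  let T : Set St := φ '' T'
  let ρ : St → Ordinal.{0} := fun τ => sInf (ρ' '' {τ' | τ' ∈ T' ∧ φ τ' = τ})
  refine ⟨T, ρ, ?_, ⟨σ', hσ', rfl⟩⟩
  intro τ hτ hQτ
  -- a preimage of least rank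
  have hne : (ρ' '' {τ' | τ' ∈ T' ∧ φ τ' = τ}).Nonempty := by
    obtain ⟨τ', hτ', rfl⟩ := hτ
    exact ⟨ρ' τ', τ', ⟨hτ', rfl⟩, rfl⟩
  obtain ⟨τ₀, ⟨hτ₀T, hτ₀φ⟩, hτ₀ρ⟩ := (Set.mem_image _ _ _).mp (csInf_mem hne)
  obtain ⟨Φ, w, hmv, hcl⟩ := hT' τ₀ hτ₀T fun hq => hQτ (hτ₀φ ▸ hQ τ₀ hq)
  have hgerm : germ τ = germ' τ₀ := by rw [← hτ₀φ, hφ]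
  refine ⟨Φ, w, hmv, ?_⟩
  rw [hgerm]
  refine hcl.mono fun b' ⟨τ'', hτ''T, hb', hlt⟩ => ⟨φ τ'', ⟨τ'', hτ''T, rfl⟩, (hφ τ'').trans hb', ?_⟩
  calc ρ (φ τ'') ≤ ρ' τ'' := csInf_le' ⟨τ'', ⟨hτ''T, rfl⟩, rfl⟩
    _ < ρ' τ₀ := hlt
    _ = ρ τ := hτ₀ρ

/-- **TRANSPORT FROM A SUBTYPE OF STATES.**  Decorated winning on a subtype of states (germ and target read through `Subtype.val`) gives
decorated winning of the underlying state. -/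
theorem DWinsTo.of_subtype {germ : St → MvPowerSeries (Fin (m + 1)) k} {C : St → Prop} {Q : St → Prop} {σ : {τ // C τ}}
    (h : DWinsTo (fun τ : {τ // C τ} => germ τ.1) (fun τ => Q τ.1) σ) : DWinsTo germ Q σ.1 :=
  h.map (germ := germ) (germ' := fun τ : {τ // C τ} => germ τ.1) Subtype.val (fun _ => rfl) (fun _ hq => hq)

/-! ## Regime theorems in well-founded-measure and no-chain form -/

/-- **WELL-FOUNDED MEASURE FORM** (generalises `DWinsTo.of_measure`, p528575, from ordinal measures to measures valued in ANY type with a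
well-founded relation `r` — `ℕ`, `ℕ ×ₗ ℕ`, label types carrying a no-chain theorem): if from every non-target member of `C` some move has, at
every answer, a successor decorated in the target or in `C` with `r`-smaller measure, then every member of `C` wins towards the target.
(Measure `:= Acc.rank`, then `DWinsTo.of_measure`.) -/
theorem DWinsTo.of_wfMeasure {germ : St → MvPowerSeries (Fin (m + 1)) k} {Q : St → Prop} (C : Set St) {α : Type}
    {r : α → α → Prop} (hwf : WellFounded r) (μ : St → α)
    (hstep : ∀ τ ∈ C, ¬ Q τ → ∃ (Φ : Fin (m + 1) → MvPowerSeries (Fin (m + 1)) k) (w : Fin (m + 1) → ℕ),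
      IsCountMove Φ w ∧ MoveClause (germ τ) Φ w (fun b' => ∃ τ', germ τ' = b' ∧ (Q τ' ∨ (τ' ∈ C ∧ r (μ τ') (μ τ)))))
    {σ : St} (hσ : σ ∈ C) : DWinsTo germ Q σ :=
  DWinsTo.of_measure C (fun τ => (hwf.apply (μ τ)).rank)
    (fun τ hτ hQ => by
      obtain ⟨Φ, w, hmv, hcl⟩ := hstep τ hτ hQ
      exact ⟨Φ, w, hmv, hcl.mono fun b' ⟨τ', hb', h⟩ =>
        ⟨τ', hb', h.imp_right fun ⟨hC, hr⟩ => ⟨hC, Acc.rank_lt_of_rel (hwf.apply (μ τ)) hr⟩⟩⟩)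
    hσ

/-- **NO-CHAIN FORM**: as `DWinsTo.of_wfMeasure`, with the well-foundedness of `r` supplied as «no infinite `r`-descending sequence» — the
shape in which the landed label theories conclude (`PolyDescent.stub_polyNoChain`, `MonicDescent.monicDescentNoChain`, …): a regime whose
every step is shadowed by an `r`-step of a label admits no infinite play, hence wins towards its exit. -/
theorem DWinsTo.of_noChain {germ : St → MvPowerSeries (Fin (m + 1)) k} {Q : St → Prop} (C : Set St) {α : Type}
    {r : α → α → Prop} (hno : ∀ f : ℕ → α, ¬ ∀ n, r (f (n + 1)) (f n)) (μ : St → α)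
    (hstep : ∀ τ ∈ C, ¬ Q τ → ∃ (Φ : Fin (m + 1) → MvPowerSeries (Fin (m + 1)) k) (w : Fin (m + 1) → ℕ),
      IsCountMove Φ w ∧ MoveClause (germ τ) Φ w (fun b' => ∃ τ', germ τ' = b' ∧ (Q τ' ∨ (τ' ∈ C ∧ r (μ τ') (μ τ)))))
    {σ : St} (hσ : σ ∈ C) : DWinsTo germ Q σ :=
  DWinsTo.of_wfMeasure C (wellFounded_iff_isEmpty_descending_chain.mpr ⟨fun f => hno f.1 f.2⟩) μ hstep hσ

/-! ## The outer induction on the head `(o, c)` -/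

/-- **THE OUTER INDUCTION (TOT2-LINE §7).**  On the product states `(b, δ)` read through `Prod.fst`: if from EVERY admissibly decorated position
the mover forces «the germ is a normal crossing, or an admissibly decorated position of strictly smaller head `(o, c)`», then from every admissibly
decorated position the mover forces a normal crossing.  (Well-founded induction on `Decoration.head ∈ ℕ ×ₗ ℕ`; the step is `DWinsTo.bind`.) -/
theorem dWinsTo_germIsNC_of_headPhase
    (hphase : ∀ (b : MvPowerSeries (Fin (m + 1)) k) (δ : Decoration k m), Admissible b δ →
      DWinsTo (St := MvPowerSeries (Fin (m + 1)) k × Decoration k m) Prod.fst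
        (fun τ => GermIsNC τ.1 ∨ (Admissible τ.1 τ.2 ∧ τ.2.head < δ.head)) (b, δ))
    {b : MvPowerSeries (Fin (m + 1)) k} {δ : Decoration k m} (hadm : Admissible b δ) :
    DWinsTo (St := MvPowerSeries (Fin (m + 1)) k × Decoration k m) Prod.fst (fun τ => GermIsNC τ.1) (b, δ) := by
  suffices H : ∀ (h : ℕ ×ₗ ℕ) (b : MvPowerSeries (Fin (m + 1)) k) (δ : Decoration k m), δ.head = h → Admissible b δ →
      DWinsTo (St := MvPowerSeries (Fin (m + 1)) k × Decoration k m) Prod.fst (fun τ => GermIsNC τ.1) (b, δ) from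
    H _ b δ rfl hadm
  intro h
  induction h using WellFoundedLT.induction with
  | ind h ih =>
    intro b δ hh hadm
    subst hh
    exact (hphase b δ hadm).bind fun τ hτ => hτ.elim (fun hnc => DWinsTo.of_target hnc)
      fun hτ' => ih τ.2.head hτ'.2 τ.1 τ.2 rfl hτ'.1

/-- **THE HEAD PHASE FROM ITS TWO HALVES.**  The `o ≥ 2` phase with target «admissibly decorated of smaller head» (the shape of res-type-056's
S-E1 and of the regime exits of TOT2-LINE v1.1 (E)) and the `o ≤ 1` endgame with target «normal crossing, or admissible of smaller head» give the
head phase hypothesis of `dWinsTo_germIsNC_of_headPhase`. -/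
theorem headPhase_of_high_of_end
    (hhigh : ∀ (b : MvPowerSeries (Fin (m + 1)) k) (δ : Decoration k m), Admissible b δ → 2 ≤ δ.o →
      DWinsTo (St := MvPowerSeries (Fin (m + 1)) k × Decoration k m) Prod.fst
        (fun τ => Admissible τ.1 τ.2 ∧ τ.2.head < δ.head) (b, δ))
    (hend : ∀ (b : MvPowerSeries (Fin (m + 1)) k) (δ : Decoration k m), Admissible b δ → δ.o ≤ 1 →
      DWinsTo (St := MvPowerSeries (Fin (m + 1)) k × Decoration k m) Prod.fst
        (fun τ => GermIsNC τ.1 ∨ (Admissible τ.1 τ.2 ∧ τ.2.head < δ.head)) (b, δ))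
    (b : MvPowerSeries (Fin (m + 1)) k) (δ : Decoration k m) (hadm : Admissible b δ) :
    DWinsTo (St := MvPowerSeries (Fin (m + 1)) k × Decoration k m) Prod.fst
      (fun τ => GermIsNC τ.1 ∨ (Admissible τ.1 τ.2 ∧ τ.2.head < δ.head)) (b, δ) := by
  rcases Nat.lt_or_ge δ.o 2 with h2 | h2
  · exact hend b δ hadm (Nat.lt_succ_iff.mp h2)
  · exact (hhigh b δ hadm h2).mono fun τ hτ => Or.inr hτ

/-- **THE INNER INDUCTION OF THE `o ≥ 2` PHASE.**  If from every admissibly decorated position with `o ≥ 2` the mover forces «admissibly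
decorated, and: strictly smaller head, or the SAME head and a strictly smaller secondary measure `ν`» — `ν` valued in any well-founded order
(the apex dimension `e^O`, a conflict count, a label rank, or a lexicographic combination) — then the `o ≥ 2` phase hypothesis `hhigh` of
`headPhase_of_high_of_end` / `ncRankDrop_of_highPhase_of_rung` holds.  (Well-founded induction on `ν` at fixed head; step `DWinsTo.bind`.) -/
theorem highPhase_of_step {α : Type} [LT α] [WellFoundedLT α] (ν : MvPowerSeries (Fin (m + 1)) k × Decoration k m → α)
    (hstep : ∀ (b : MvPowerSeries (Fin (m + 1)) k) (δ : Decoration k m), Admissible b δ → 2 ≤ δ.o →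
      DWinsTo (St := MvPowerSeries (Fin (m + 1)) k × Decoration k m) Prod.fst
        (fun τ => Admissible τ.1 τ.2 ∧ (τ.2.head < δ.head ∨ (τ.2.head = δ.head ∧ ν τ < ν (b, δ)))) (b, δ))
    (b : MvPowerSeries (Fin (m + 1)) k) (δ : Decoration k m) (hadm : Admissible b δ) (ho : 2 ≤ δ.o) :
    DWinsTo (St := MvPowerSeries (Fin (m + 1)) k × Decoration k m) Prod.fst
      (fun τ => Admissible τ.1 τ.2 ∧ τ.2.head < δ.head) (b, δ) := by
  suffices H : ∀ (a : α) (b' : MvPowerSeries (Fin (m + 1)) k) (δ' : Decoration k m), ν (b', δ') = a → Admissible b' δ' →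
      δ'.head = δ.head →
      DWinsTo (St := MvPowerSeries (Fin (m + 1)) k × Decoration k m) Prod.fst
        (fun τ => Admissible τ.1 τ.2 ∧ τ.2.head < δ.head) (b', δ') from H _ b δ rfl hadm rfl
  intro a
  induction a using WellFoundedLT.induction with
  | ind a ih =>
    intro b' δ' ha hadm' hh
    subst ha
    have ho' : 2 ≤ δ'.o := by
      have hh' := hh
      rw [Decoration.head, Decoration.head, toLex_inj] at hh'
      have hoo : δ'.o = δ.o := (Prod.ext_iff.mp hh').1
      rw [hoo]
      exact ho
    refine (hstep b' δ' hadm' ho').bind fun τ hτ => ?_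
    rcases hτ with ⟨hadmτ, hlt | ⟨heq, hν⟩⟩
    · exact DWinsTo.of_target ⟨hadmτ, hh ▸ hlt⟩
    · exact ih (ν τ) hν τ.1 τ.2 rfl hadmτ (heq.trans hh)

/-- **THE ENDGAME ON PRODUCT STATES, from the bare rung R8** (transport of res-D-pv-006's `dWinsTo_end_of_rung` off the admissible subtype):
every admissibly decorated position with `o ≤ 1` wins towards «the germ is a normal crossing». -/
theorem endPhase_of_rung
    (hR8 : ∀ f : MvPowerSeries (Fin (m + 1)) k, f.order = 1 → ∀ E : Finset (Fin (m + 1)),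
      ∃ n, WinsIn (m := m) GermIsNC n (f * ∏ l ∈ E, X l))
    (b : MvPowerSeries (Fin (m + 1)) k) (δ : Decoration k m) (hadm : Admissible b δ) (ho : δ.o ≤ 1) :
    DWinsTo (St := MvPowerSeries (Fin (m + 1)) k × Decoration k m) Prod.fst (fun τ => GermIsNC τ.1) (b, δ) :=
  (dWinsTo_end_of_rung hR8 ⟨(b, δ), hadm⟩ ho).map (germ := Prod.fst)
    (germ' := fun τ : {p : MvPowerSeries (Fin (m + 1)) k × Decoration k m // Admissible p.1 p.2} => τ.1.1)
    (Q := fun τ : MvPowerSeries (Fin (m + 1)) k × Decoration k m => GermIsNC τ.1)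
    Subtype.val (fun _ => rfl) (fun _ hq => hq)

/-- The endgame half of the head phase from the bare rung R8 (target widened to the head-phase disjunction). -/
theorem endPhase_of_rung'
    (hR8 : ∀ f : MvPowerSeries (Fin (m + 1)) k, f.order = 1 → ∀ E : Finset (Fin (m + 1)),
      ∃ n, WinsIn (m := m) GermIsNC n (f * ∏ l ∈ E, X l))
    (b : MvPowerSeries (Fin (m + 1)) k) (δ : Decoration k m) (hadm : Admissible b δ) (ho : δ.o ≤ 1) :
    DWinsTo (St := MvPowerSeries (Fin (m + 1)) k × Decoration k m) Prod.fst
      (fun τ => GermIsNC τ.1 ∨ (Admissible τ.1 τ.2 ∧ τ.2.head < δ.head)) (b, δ) :=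
  (endPhase_of_rung hR8 b δ hadm ho).mono fun _ hτ => Or.inl hτ

/-! ## Extraction of the positional rank -/

/-- **POSITIONAL RANK FROM THE HEAD PHASE.**  If from every admissibly decorated position the mover forces «NC, or admissible of smaller head»,
then ONE ordinal rank on germs is lowered by some count-game move at every answer from every non-zero germ that is not a normal crossing — the
hypothesis text of `tameWideApexFourStartsWon_of_ncRankDrop` (p526032) / the registered stub `stub_spaceNCRankDrop` at `m + 1 = 3`.
(`admissible_start`: every non-zero germ is admissibly decorated; `ncRankDrop_of_dWinsTo` with the radical heredity of `GermIsNC`.) -/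
theorem ncRankDrop_of_headPhase
    (hphase : ∀ (b : MvPowerSeries (Fin (m + 1)) k) (δ : Decoration k m), Admissible b δ →
      DWinsTo (St := MvPowerSeries (Fin (m + 1)) k × Decoration k m) Prod.fst
        (fun τ => GermIsNC τ.1 ∨ (Admissible τ.1 τ.2 ∧ τ.2.head < δ.head)) (b, δ)) :
    ∃ ρ : MvPowerSeries (Fin (m + 1)) k → Ordinal.{0}, ∀ b : MvPowerSeries (Fin (m + 1)) k, b ≠ 0 → ¬ GermIsNC b →
      ∃ (Φ : Fin (m + 1) → MvPowerSeries (Fin (m + 1)) k) (w : Fin (m + 1) → ℕ),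
        IsCountMove Φ w ∧ MoveClause b Φ w (fun b' => ρ b' < ρ b) :=
  ncRankDrop_of_dWinsTo (St := MvPowerSeries (Fin (m + 1)) k × Decoration k m) (germ := Prod.fst)
    (fun N b d hd hnc hbd => germIsNC_of_dvd_pow N b d hd hnc hbd)
    fun b hb => ⟨(b, Decoration.start (sqfRep b)), rfl, dWinsTo_germIsNC_of_headPhase hphase (admissible_start hb)⟩

/-- **POSITIONAL RANK FROM THE TWO HALVES** (`o ≥ 2` phase + `o ≤ 1` endgame). -/
theorem ncRankDrop_of_high_of_end
    (hhigh : ∀ (b : MvPowerSeries (Fin (m + 1)) k) (δ : Decoration k m), Admissible b δ → 2 ≤ δ.o →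
      DWinsTo (St := MvPowerSeries (Fin (m + 1)) k × Decoration k m) Prod.fst
        (fun τ => Admissible τ.1 τ.2 ∧ τ.2.head < δ.head) (b, δ))
    (hend : ∀ (b : MvPowerSeries (Fin (m + 1)) k) (δ : Decoration k m), Admissible b δ → δ.o ≤ 1 →
      DWinsTo (St := MvPowerSeries (Fin (m + 1)) k × Decoration k m) Prod.fst
        (fun τ => GermIsNC τ.1 ∨ (Admissible τ.1 τ.2 ∧ τ.2.head < δ.head)) (b, δ)) :
    ∃ ρ : MvPowerSeries (Fin (m + 1)) k → Ordinal.{0}, ∀ b : MvPowerSeries (Fin (m + 1)) k, b ≠ 0 → ¬ GermIsNC b →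
      ∃ (Φ : Fin (m + 1) → MvPowerSeries (Fin (m + 1)) k) (w : Fin (m + 1) → ℕ),
        IsCountMove Φ w ∧ MoveClause b Φ w (fun b' => ρ b' < ρ b) :=
  ncRankDrop_of_headPhase (headPhase_of_high_of_end hhigh hend)

/-- **POSITIONAL RANK FROM THE `o ≥ 2` PHASE AND THE BARE RUNG R8.** -/
theorem ncRankDrop_of_highPhase_of_rung
    (hR8 : ∀ f : MvPowerSeries (Fin (m + 1)) k, f.order = 1 → ∀ E : Finset (Fin (m + 1)),
      ∃ n, WinsIn (m := m) GermIsNC n (f * ∏ l ∈ E, X l))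
    (hhigh : ∀ (b : MvPowerSeries (Fin (m + 1)) k) (δ : Decoration k m), Admissible b δ → 2 ≤ δ.o →
      DWinsTo (St := MvPowerSeries (Fin (m + 1)) k × Decoration k m) Prod.fst
        (fun τ => Admissible τ.1 τ.2 ∧ τ.2.head < δ.head) (b, δ)) :
    ∃ ρ : MvPowerSeries (Fin (m + 1)) k → Ordinal.{0}, ∀ b : MvPowerSeries (Fin (m + 1)) k, b ≠ 0 → ¬ GermIsNC b →
      ∃ (Φ : Fin (m + 1) → MvPowerSeries (Fin (m + 1)) k) (w : Fin (m + 1) → ℕ),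
        IsCountMove Φ w ∧ MoveClause b Φ w (fun b' => ρ b' < ρ b) :=
  ncRankDrop_of_high_of_end hhigh (endPhase_of_rung' hR8)

/-- **THE REGISTERED STUB'S TEXT (`stub_spaceNCRankDrop`, skeleton v32, `m + 1 = 3`) FROM THE `o ≥ 2` PHASE AND R8**, both taken under the
stub's own binders `∀ p prime, ∀ k, [Field k] [CharP k p] [IsAlgClosed k]`. -/
theorem spaceNCRankDrop_of_highPhase_of_rung
    (hR8 : ∀ (p : ℕ), p.Prime → ∀ (k : Type) [Field k] [CharP k p] [IsAlgClosed k],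
      ∀ f : MvPowerSeries (Fin 3) k, f.order = 1 → ∀ E : Finset (Fin 3), ∃ n, WinsIn (m := 2) GermIsNC n (f * ∏ l ∈ E, X l))
    (hhigh : ∀ (p : ℕ), p.Prime → ∀ (k : Type) [Field k] [CharP k p] [IsAlgClosed k],
      ∀ (b : MvPowerSeries (Fin 3) k) (δ : Decoration k 2), Admissible b δ → 2 ≤ δ.o →
        DWinsTo (St := MvPowerSeries (Fin 3) k × Decoration k 2) Prod.fst
          (fun τ => Admissible τ.1 τ.2 ∧ τ.2.head < δ.head) (b, δ)) :
    ∀ (p : ℕ), p.Prime → ∀ (k : Type) [Field k] [CharP k p] [IsAlgClosed k],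
      ∃ ρ : MvPowerSeries (Fin 3) k → Ordinal.{0}, ∀ b : MvPowerSeries (Fin 3) k, b ≠ 0 → ¬ GermIsNC b →
        ∃ (Φ : Fin 3 → MvPowerSeries (Fin 3) k) (w : Fin 3 → ℕ),
          IsCountMove (m := 2) Φ w ∧ MoveClause (m := 2) b Φ w (fun b' => ρ b' < ρ b) :=
  fun p hp k _ _ _ => ncRankDrop_of_highPhase_of_rung (hR8 p hp k) (hhigh p hp k)

/-! ## Ordinal reading of the head order (for hands using ordinal measures) -/

/-- `ω·a + b < ω·a' + b'` for naturals `a < a'` (any `b, b'`). -/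
theorem omega0_mul_add_lt_omega0_mul_add_of_lt {a a' : ℕ} (h : a < a') (b b' : ℕ) :
    (Ordinal.omega0 * a + b : Ordinal.{0}) < Ordinal.omega0 * a' + b' :=
  calc (Ordinal.omega0 * a + b : Ordinal.{0}) < Ordinal.omega0 * a + Ordinal.omega0 :=
        (add_lt_add_iff_left _).mpr (Ordinal.natCast_lt_omega0 b)
    _ = Ordinal.omega0 * ((a + 1 : ℕ) : Ordinal.{0}) := by rw [Nat.cast_succ, mul_add_one]
    _ ≤ Ordinal.omega0 * a' := mul_le_mul_right (Nat.cast_le.mpr (Nat.succ_le_of_lt h)) _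
    _ ≤ Ordinal.omega0 * a' + b' := le_self_add

/-- **LEX ON `ℕ × ℕ` AS ORDINALS BELOW `ω²`:** `ω·a + b < ω·a' + b' ↔ a < a' ∨ (a = a' ∧ b < b')`. -/
theorem omega0_mul_add_lt_iff {a b a' b' : ℕ} :
    (Ordinal.omega0 * a + b : Ordinal.{0}) < Ordinal.omega0 * a' + b' ↔ a < a' ∨ (a = a' ∧ b < b') := by
  constructor
  · intro h
    rcases lt_trichotomy a a' with haa | rfl | haa
    · exact Or.inl haa
    · exact Or.inr ⟨rfl, Nat.cast_lt.mp ((add_lt_add_iff_left _).mp h)⟩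
    · exact absurd h (not_lt_of_gt (omega0_mul_add_lt_omega0_mul_add_of_lt haa b' b))
  · rintro (haa | ⟨rfl, hbb⟩)
    · exact omega0_mul_add_lt_omega0_mul_add_of_lt haa b b'
    · exact (add_lt_add_iff_left _).mpr (Nat.cast_lt.mpr hbb)

/-- **THE HEAD ORDER AS AN ORDINAL MEASURE:** `δ'.head < δ.head ↔ ω·δ'.o + δ'.c < ω·δ.o + δ.c` — so `fun τ => ω * τ.2.o + τ.2.c` (possibly
refined lexicographically below by further letters) is a legitimate `μ` for `DWinsTo.of_measure` / `DWinsTo.wf_induction`. -/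
theorem Decoration.head_lt_iff_omega0 (δ δ' : Decoration k m) :
    δ'.head < δ.head ↔ (Ordinal.omega0 * δ'.o + δ'.c : Ordinal.{0}) < Ordinal.omega0 * δ.o + δ.c := by
  rw [omega0_mul_add_lt_iff, Decoration.head, Decoration.head, Prod.Lex.toLex_lt_toLex]

/-! ## Appendix (gen 6, second landing): the inner induction with normal-crossing exits -/

/-- **THE INNER INDUCTION WITH NORMAL-CROSSING EXITS.**  As `highPhase_of_step`, but the step may also end in «the germ is a normal crossing»
at the same head (the shape of res-L1-w43-lead-1's S-E2′ exit `NCPoly.Exit = IsStdNC ∨ …`, p537081): if from every admissibly decorated position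
with `o ≥ 2` the mover forces «NC, or admissible with smaller head, or admissible with the same head and smaller `ν`», then from every such
position it forces «NC, or admissible with smaller head» — the `o ≥ 2` half of the head phase hypothesis of `dWinsTo_germIsNC_of_headPhase`. -/
theorem headPhase_of_step {α : Type} [LT α] [WellFoundedLT α] (ν : MvPowerSeries (Fin (m + 1)) k × Decoration k m → α)
    (hstep : ∀ (b : MvPowerSeries (Fin (m + 1)) k) (δ : Decoration k m), Admissible b δ → 2 ≤ δ.o →
      DWinsTo (St := MvPowerSeries (Fin (m + 1)) k × Decoration k m) Prod.fst
        (fun τ => GermIsNC τ.1 ∨ (Admissible τ.1 τ.2 ∧ (τ.2.head < δ.head ∨ (τ.2.head = δ.head ∧ ν τ < ν (b, δ))))) (b, δ))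
    (b : MvPowerSeries (Fin (m + 1)) k) (δ : Decoration k m) (hadm : Admissible b δ) (ho : 2 ≤ δ.o) :
    DWinsTo (St := MvPowerSeries (Fin (m + 1)) k × Decoration k m) Prod.fst
      (fun τ => GermIsNC τ.1 ∨ (Admissible τ.1 τ.2 ∧ τ.2.head < δ.head)) (b, δ) := by
  suffices H : ∀ (a : α) (b' : MvPowerSeries (Fin (m + 1)) k) (δ' : Decoration k m), ν (b', δ') = a → Admissible b' δ' →
      δ'.head = δ.head →
      DWinsTo (St := MvPowerSeries (Fin (m + 1)) k × Decoration k m) Prod.fst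
        (fun τ => GermIsNC τ.1 ∨ (Admissible τ.1 τ.2 ∧ τ.2.head < δ.head)) (b', δ') from H _ b δ rfl hadm rfl
  intro a
  induction a using WellFoundedLT.induction with
  | ind a ih =>
    intro b' δ' ha hadm' hh
    subst ha
    have ho' : 2 ≤ δ'.o := by
      have hh' := hh
      rw [Decoration.head, Decoration.head, toLex_inj] at hh'
      have hoo : δ'.o = δ.o := (Prod.ext_iff.mp hh').1
      rw [hoo]
      exact ho
    refine (hstep b' δ' hadm' ho').bind fun τ hτ => ?_
    rcases hτ with hnc | ⟨hadmτ, hlt | ⟨heq, hν⟩⟩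
    · exact DWinsTo.of_target (Or.inl hnc)
    · exact DWinsTo.of_target (Or.inr ⟨hadmτ, hh ▸ hlt⟩)
    · exact ih (ν τ) hν τ.1 τ.2 rfl hadmτ (heq.trans hh)

/-- **THE HEAD PHASE FROM THE NC-TOLERANT INNER STEP AND THE ENDGAME.** -/
theorem headPhase_of_step_of_end {α : Type} [LT α] [WellFoundedLT α] (ν : MvPowerSeries (Fin (m + 1)) k × Decoration k m → α)
    (hstep : ∀ (b : MvPowerSeries (Fin (m + 1)) k) (δ : Decoration k m), Admissible b δ → 2 ≤ δ.o →
      DWinsTo (St := MvPowerSeries (Fin (m + 1)) k × Decoration k m) Prod.fst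
        (fun τ => GermIsNC τ.1 ∨ (Admissible τ.1 τ.2 ∧ (τ.2.head < δ.head ∨ (τ.2.head = δ.head ∧ ν τ < ν (b, δ))))) (b, δ))
    (hend : ∀ (b : MvPowerSeries (Fin (m + 1)) k) (δ : Decoration k m), Admissible b δ → δ.o ≤ 1 →
      DWinsTo (St := MvPowerSeries (Fin (m + 1)) k × Decoration k m) Prod.fst
        (fun τ => GermIsNC τ.1 ∨ (Admissible τ.1 τ.2 ∧ τ.2.head < δ.head)) (b, δ))
    (b : MvPowerSeries (Fin (m + 1)) k) (δ : Decoration k m) (hadm : Admissible b δ) :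
    DWinsTo (St := MvPowerSeries (Fin (m + 1)) k × Decoration k m) Prod.fst
      (fun τ => GermIsNC τ.1 ∨ (Admissible τ.1 τ.2 ∧ τ.2.head < δ.head)) (b, δ) := by
  rcases Nat.lt_or_ge δ.o 2 with h2 | h2
  · exact hend b δ hadm (Nat.lt_succ_iff.mp h2)
  · exact headPhase_of_step ν hstep b δ hadm h2

/-- **POSITIONAL RANK FROM THE NC-TOLERANT INNER STEP AND THE BARE RUNG R8** (m-generic). -/
theorem ncRankDrop_of_step_of_rung {α : Type} [LT α] [WellFoundedLT α] (ν : MvPowerSeries (Fin (m + 1)) k × Decoration k m → α)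
    (hR8 : ∀ f : MvPowerSeries (Fin (m + 1)) k, f.order = 1 → ∀ E : Finset (Fin (m + 1)),
      ∃ n, WinsIn (m := m) GermIsNC n (f * ∏ l ∈ E, X l))
    (hstep : ∀ (b : MvPowerSeries (Fin (m + 1)) k) (δ : Decoration k m), Admissible b δ → 2 ≤ δ.o →
      DWinsTo (St := MvPowerSeries (Fin (m + 1)) k × Decoration k m) Prod.fst
        (fun τ => GermIsNC τ.1 ∨ (Admissible τ.1 τ.2 ∧ (τ.2.head < δ.head ∨ (τ.2.head = δ.head ∧ ν τ < ν (b, δ))))) (b, δ)) :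
    ∃ ρ : MvPowerSeries (Fin (m + 1)) k → Ordinal.{0}, ∀ b : MvPowerSeries (Fin (m + 1)) k, b ≠ 0 → ¬ GermIsNC b →
      ∃ (Φ : Fin (m + 1) → MvPowerSeries (Fin (m + 1)) k) (w : Fin (m + 1) → ℕ),
        IsCountMove Φ w ∧ MoveClause b Φ w (fun b' => ρ b' < ρ b) :=
  ncRankDrop_of_headPhase (headPhase_of_step_of_end ν hstep (endPhase_of_rung' hR8))

/-- **THE REGISTERED STUB'S TEXT FROM THE NC-TOLERANT INNER STEP AND R8** (`m + 1 = 3`, both under the stub's binders; the measure type `α`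
and the measure `ν` may depend on `p` and `k`). -/
theorem spaceNCRankDrop_of_step_of_rung
    (hR8 : ∀ (p : ℕ), p.Prime → ∀ (k : Type) [Field k] [CharP k p] [IsAlgClosed k],
      ∀ f : MvPowerSeries (Fin 3) k, f.order = 1 → ∀ E : Finset (Fin 3), ∃ n, WinsIn (m := 2) GermIsNC n (f * ∏ l ∈ E, X l))
    (hstep : ∀ (p : ℕ), p.Prime → ∀ (k : Type) [Field k] [CharP k p] [IsAlgClosed k],
      ∃ (α : Type) (_ : LT α) (_ : WellFoundedLT α) (ν : MvPowerSeries (Fin 3) k × Decoration k 2 → α),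
        ∀ (b : MvPowerSeries (Fin 3) k) (δ : Decoration k 2), Admissible b δ → 2 ≤ δ.o →
          DWinsTo (St := MvPowerSeries (Fin 3) k × Decoration k 2) Prod.fst
            (fun τ => GermIsNC τ.1 ∨ (Admissible τ.1 τ.2 ∧ (τ.2.head < δ.head ∨ (τ.2.head = δ.head ∧ ν τ < ν (b, δ))))) (b, δ)) :
    ∀ (p : ℕ), p.Prime → ∀ (k : Type) [Field k] [CharP k p] [IsAlgClosed k],
      ∃ ρ : MvPowerSeries (Fin 3) k → Ordinal.{0}, ∀ b : MvPowerSeries (Fin 3) k, b ≠ 0 → ¬ GermIsNC b →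
        ∃ (Φ : Fin 3 → MvPowerSeries (Fin 3) k) (w : Fin 3 → ℕ),
          IsCountMove (m := 2) Φ w ∧ MoveClause (m := 2) b Φ w (fun b' => ρ b' < ρ b) := by
  intro p hp k _ _ _
  obtain ⟨α, _, _, ν, hν⟩ := hstep p hp k
  exact ncRankDrop_of_step_of_rung ν (hR8 p hp k) hν

end TameFourTupleDrop

end Summit.ResolutionOfSingularities.ResolutionOfSingularities.Theorems
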